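import Summits.Ventures.YMGap.RobustBall.HeatBathPoincareZdBall
import Summits.Ventures.YMGap.RobustBall.LangevinPoincare
import Summits.Ventures.YMGap.RobustBall.VarianceTiltTools
import Literature.Probability.LatticeModels.DobrushinMetricInfiniteRange
import Literature.Probability.LatticeModels.BoundaryLawFunctionalLevels
import Literature.MathematicalPhysics.QuantumFieldTheory.ShenZhuZhuLogSobolev
import Literature.Probability.LatticeModels.GibbsExistenceSummablePotential
import HarnessLib

/-!
# Robust ball (Y2) — THE LANGEVIN (GRADIENT-FORM) POINCARÉ INEQUALITY OF EVERY FINITE VOLUME OF `ℤ^d` WITH BOUNDARY CONDITION, UNIFORMLY IN THE VOLUME,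
# THE BOUNDARY FIELD AND THE MEMBER OF THE `ℤ^d` BALL

HONEST FRAMING: venture file of the cell `pub-ymgap` (QuantumFields programme), track ROBUST-BALL, seat rb-p2 (g13); the BALL-UNIFORM version of
`LangevinPoincareZd.lean` (Wilson kernels) on top of `HeatBathPoincareZdBall.lean` (Glauber gap of the member's kernels).  LATTICE statements at STRONG COUPLING
for the perturbed specifications `γ^W_V(·|η) = perturbedYM χ_N (Nβ) W supp V η` ('t Hooft `β`) of the members of rb-p1's `ℤ^d` ball (link potentials with
continuous own-link terms, support `supp`, per-link loads `a` (oscillation), `ℓ_s` (self-Lipschitz) and the COLUMN cross-Lipschitz load `Λc`); constants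
independent of `V`, `η` and the member; nothing about `β → ∞`, the continuum or Clay.
THE STATEMENT (★★★ `kernel_variance_le_integral_Gam_onBall`): `OneLinkKRModulus N b K` on `b ≥ 2(d−1)|β|`, `c := 6(d−1)|β|K e^{a}(1 + 2√N ℓ_s) + √N Λc < 1`,
`K₀ := N/2 − N|β|·2(d−1) > 0` ⇒ for EVERY member, EVERY finite volume `V`, EVERY boundary field `η` and every smooth `f` of the link matrices over `V`,
`Var_{γ^W_V(·|η)}(f) ≤ e^{a} ((1 − c)K₀)⁻¹ ∫ Γ(f,f) dγ^W_V(·|η)` — Langevin gap `≥ e^{−a}(1 − c)K₀` (standard reading), uniformly in `V`, `η` and the member.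
★★ `su2_kernel_variance_le_integral_Gam_onBall_quarter`: `SU(2)`, every `d`, quarter modulus (`c = (3/2)(d−1)β_W e^{a}(1 + 2√2 ℓ_s) + √2 Λc`, `K₀ = 1 − (d−1)β_W`).
MECHANISM: `HeatBathPoincareZdBall.kernelVariance_le_onBall` ∘ properness (`siteAvg_eq_integral_siteLaw`) ∘ the member's one-link law in 't Hooft form
`ν_{B_U}.tilted(−H^W_{x}(U[x ↦ ·]))` (`siteLaw_perturbedYM_thooft`, oscillation `≤ a` by `hamiltonianIn_singleton_update_osc`) ∘ one-link Bakry–Émery for the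
section (`LangevinPoincare.section_variance_le`) transported by Holley–Stroock (`variance_tilted_le_of_osc`) ∘ consistency `γ_V γ_{x} = γ_V`.  0 sorry,
0 definitions.  References: H. Shen, R. Zhu, X. Zhu, CMP 400 (2023) 805; R. Holley, D. Stroock, J. Stat. Phys. 46 (1987) 1159; L. Wu, Ann. Probab. 34 (2006) 1960.
Everything here is proved. [folklore]
-/

noncomputable section

open scoped Matrix ComplexConjugate BigOperators Matrix.Norms.Frobenius ContDiff Topology ProbabilityTheory
open Matrix Complex Finset MeasureTheory Filter ProbabilityTheory Function Real
open Literature.Probability.LatticeModels Literature.Probability.LatticeModels.DobrushinMetric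
open Literature.MathematicalPhysics.QuantumLattice hiding torusNorm
open Literature.MathematicalPhysics.QuantumFieldTheory hiding ZdEdge
open Summit.QuantumFields.YangMills.Theorems.StrongPinningPoincare
open Literature.MathematicalPhysics.QuantumFieldTheory.SUNBakryEmery (SUN FrameIdx frame haarSU pot)
open Literature.MathematicalPhysics.QuantumFieldTheory.Balaban1983to89.StrongCouplingDobrushinWindow (OneLinkKRModulus)
open Summit.Ventures.YMGap.LatticeBakryEmery
open Summit.Ventures.YMGap.RobustBall.HeatBathPoincareZdBall (kernelVariance_le_onBall)

namespace Summit.Ventures.YMGap.RobustBall.LangevinPoincare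

variable {d N : ℕ}

/-- ★★★ **THE LANGEVIN (GRADIENT-FORM) POINCARÉ INEQUALITY OF A FINITE VOLUME WITH BOUNDARY CONDITION, UNIFORMLY IN THE VOLUME, THE BOUNDARY FIELD AND
THE MEMBER OF THE `ℤ^d` BALL** (`SU(N)`, 't Hooft coupling `β`): `OneLinkKRModulus N b K` on `b ≥ 2(d−1)|β|`, a member `W` with per-link loads `a`, `ℓ_s`
and column load `Λc`, `c := 6(d−1)|β| K e^{a}(1 + 2√N ℓ_s) + √N Λc < 1`, `K₀ := N/2 − N|β|·2(d−1) > 0` ⇒ for every finite link volume `V`, every boundary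
field `η` and every smooth `f` of the link matrices over `V`, `Var_{γ^W_V(·|η)}(f) ≤ e^{a} ((1 − c)K₀)⁻¹ ∫ Γ(f,f) dγ^W_V(·|η)`. [folklore] -/
theorem kernel_variance_le_integral_Gam_onBall (hd : 1 ≤ d) (hN : 1 ≤ N) {β b K a ℓs Λc c : ℝ} (hK : 0 ≤ K) (hℓs : 0 ≤ ℓs)
    (hb : |β| * (2 * ((d : ℝ) - 1)) ≤ b) (hmod : OneLinkKRModulus N b K)
    {W : Potential (ZdEdge d) (SUN N)} (hWc : ∀ X, Continuous (W X)) (hWdep : ∀ X, DependsOn (W X) (↑X : Set (ZdEdge d)))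
    {supp : Finset (ZdEdge d) → Finset (Finset (ZdEdge d))} (hsupp : W.IsSupportedBy supp)
    {osc : Finset (ZdEdge d) → ZdEdge d → ℝ} (hosc : ∀ X, Dobrushin.IsOscBound (W X) (osc X))
    (hosca : ∀ e, ∑ X ∈ (supp {e}).filter (fun X => e ∈ X), osc X e ≤ a)
    {lip : Finset (ZdEdge d) → ZdEdge d → ℝ} (hlip : ∀ X, IsLipBound suFrobDist (W X) (lip X))
    (hlips : ∀ e, ∑ X ∈ (supp {e}).filter (fun X => e ∈ X), lip X e ≤ ℓs)
    (hcol : ∀ (y : ZdEdge d) (T : Finset (ZdEdge d)), y ∉ T → ∑ e ∈ T, ∑ X ∈ (supp {e}).filter (fun X => e ∈ X), lip X y ≤ Λc)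
    (hc : 6 * ((d : ℝ) - 1) * |β| * (K * Real.exp a * (1 + 2 * Real.sqrt N * ℓs)) + Real.sqrt N * Λc ≤ c) (hc1 : c < 1)
    (hK₀ : 0 < (N : ℝ) / 2 - N * |β| * (2 * ((d : ℝ) - 1)))
    (V : Finset (ZdEdge d)) (η : LGConfig d (SUN N)) {f : Cfg ↥V N → ℝ} (hf : ContDiff ℝ ∞ f) :
    Var[matrixCylinder V f; perturbedYM (fundamentalRep (Fin N)) ((N : ℝ) * β) W supp V η] ≤
      Real.exp a * ((1 - c) * ((N : ℝ) / 2 - N * |β| * (2 * ((d : ℝ) - 1))))⁻¹ *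
        ∫ U, Gam f f (fun e : ↥V => (U e : Matrix (Fin N) (Fin N) ℂ)) ∂(perturbedYM (fundamentalRep (Fin N)) ((N : ℝ) * β) W supp V η) := by
  classical
  haveI : SecondCountableTopology (Matrix (Fin N) (Fin N) ℂ) := inferInstanceAs (SecondCountableTopology (Fin N → Fin N → ℂ))
  haveI : SecondCountableTopology (SUN N) := Topology.IsEmbedding.subtypeVal.secondCountableTopology
  have hN0 : N ≠ 0 := by omega
  have hNpos : (0 : ℝ) < N := by exact_mod_cast Nat.pos_of_ne_zero hN0
  have hρc := continuous_fundamentalRep (Fin N)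
  have hW : W.IsAdapted := fun X => ⟨hWdep X, (hWc X).measurable⟩
  have hWm : ∀ X, Measurable (W X) := fun X => (hWc X).measurable
  have hWb : ∀ X, ∃ C, ∀ U, |W X U| ≤ C := fun X => exists_bound_of_continuous (hWc X)
  set K₀ : ℝ := (N : ℝ) / 2 - N * |β| * (2 * ((d : ℝ) - 1)) with hK₀def
  set γ := perturbedYM (d := d) (fundamentalRep (Fin N)) ((N : ℝ) * β) W supp with hγdef
  have hγ : IsSpecification γ := isSpecification_perturbedYM _ hρc _ hW hWb hsupp
  set μ : Measure (LGConfig d (SUN N)) := γ V η with hμdef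
  haveI : IsProbabilityMeasure μ := hγ.isProbability V η
  have hc0 : 0 < 1 - c := by linarith
  -- the observable and the link blocks of `Γ`
  set cfgV : LGConfig d (SUN N) → Cfg ↥V N := fun U e => (U e : Matrix (Fin N) (Fin N) ℂ) with hcfgV
  have hcfgc : Continuous cfgV := continuous_pi fun e => continuous_subtype_val.comp (continuous_apply _)
  have hcfg_upd : ∀ {x : ZdEdge d} (hx : x ∈ V) (U : LGConfig d (SUN N)) (s : SUN N),
      cfgV (update U x s) = update (cfgV U) ⟨x, hx⟩ (s : Matrix (Fin N) (Fin N) ℂ) := by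
    intro x hx U s
    funext e
    by_cases he : e = ⟨x, hx⟩
    · subst he; simp [hcfgV]
    · have he' : (e : ZdEdge d) ≠ x := fun h => he (Subtype.ext h)
      simp only [hcfgV]
      rw [update_of_ne he, update_of_ne he']
  set F : LGConfig d (SUN N) → ℝ := matrixCylinder V f with hFdef
  have hFeq : ∀ U, F U = f (cfgV U) := fun U => rfl
  have hFc : Continuous F := hf.continuous.comp hcfgc
  have hFm : Measurable F := hFc.measurable
  obtain ⟨M, hM⟩ := exists_bound_of_continuous hFc
  set blk : ZdEdge d → LGConfig d (SUN N) → ℝ := fun x U =>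
    if hx : x ∈ V then ∑ α : FrameIdx N, algD (lk (⟨x, hx⟩ : ↥V) (frame α)) f (cfgV U) ^ 2 else 0 with hblk
  have hblk_of_mem : ∀ {x} (hx : x ∈ V) (U : LGConfig d (SUN N)), blk x U = ∑ α : FrameIdx N, algD (lk (⟨x, hx⟩ : ↥V) (frame α)) f (cfgV U) ^ 2 :=
    fun hx U => by simp only [hblk, dif_pos hx]
  have hblkc : ∀ {x} (hx : x ∈ V), Continuous (blk x) := fun {x} hx => by
    have h : blk x = fun U => ∑ α : FrameIdx N, algD (lk (⟨x, hx⟩ : ↥V) (frame α)) f (cfgV U) ^ 2 := funext (hblk_of_mem hx)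
    rw [h]
    exact continuous_finsetSum _ fun α _ => ((contDiff_algD hf _).continuous.comp hcfgc).pow 2
  have hpos : 0 ≤ Real.exp a * ((1 - c) * K₀)⁻¹ := mul_nonneg (Real.exp_pos _).le (inv_nonneg.2 (mul_nonneg hc0.le hK₀.le))
  -- the empty volume: the kernel is a point mass, the variance vanishes
  by_cases hVne : V = ∅
  · have hconst : ∀ᵐ U ∂μ, F U = F η := by
      filter_upwards [hγ.proper V η] with U hU
      have : U = η := funext fun z => hU z (by simp [hVne])
      rw [this]
    have hvar0 : Var[F; μ] = 0 := by
      rw [variance_eq_integral hFm.aemeasurable]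
      have hmean : ∫ U, F U ∂μ = F η := by rw [integral_congr_ae hconst]; simp
      have h2 : (fun U => (F U - ∫ U', F U' ∂μ) ^ 2) =ᵐ[μ] fun _ => (0 : ℝ) := by
        filter_upwards [hconst] with U hU
        rw [hU, hmean, sub_self]
        ring
      rw [integral_congr_ae h2]
      simp
    rw [hvar0]
    exact mul_nonneg hpos (integral_nonneg fun U => Gam_self_nonneg f _)
  have hVne' : V.Nonempty := Finset.nonempty_iff_ne_empty.2 hVne
  -- (1) the member's kernel heat-bath Poincaré inequality
  have hHB := kernelVariance_le_onBall hd hN hK hℓs hb hmod hWc hWdep hsupp hosc hosca hlip hlips hcol hc hc1 hVne' η hFm ⟨M, hM⟩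
  -- (2)+(3) PER LINK of the volume
  have key : ∀ x ∈ V, ∫ U, ∫ σ, (F U - F σ) ^ 2 ∂(γ {x} U) ∂μ ≤ 2 * (Real.exp a * K₀⁻¹) * ∫ U, blk x U ∂μ := by
    intro x hx
    have hlaw : ∀ U, IsProbabilityMeasure (siteLaw γ x U) := fun U => isProbabilityMeasure_siteLaw hγ x U
    set m : LGConfig d (SUN N) → ℝ := siteAvg γ x F with hmdef
    have hmm : Measurable m := measurable_siteAvg hγ x hFm
    have hmb : ∀ U, |m U| ≤ M := fun U => abs_siteAvg_le hγ x hM U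
    have hm_eq : ∀ U, m U = ∫ s, F (update U x s) ∂(siteLaw γ x U) := fun U => siteAvg_eq_integral_siteLaw hγ x hFm U
    have hm_upd : ∀ U s, m (update U x s) = m U := fun U s => by
      rw [hm_eq, hm_eq, siteLaw_congr_of_eq_off' hγ x (fun z hz => update_of_ne hz _ _)]
      simp only [update_idem]
    have hh : Measurable fun U => (F U - m U) ^ 2 := (hFm.sub hmm).pow_const 2
    have hhb : ∀ U, |(F U - m U) ^ 2| ≤ (2 * M) ^ 2 := fun U => by
      rw [abs_pow]
      refine pow_le_pow_left₀ (abs_nonneg _) ((abs_sub _ _).trans ?_) 2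
      linarith [hM U, hmb U]
    obtain ⟨Mb, hMb⟩ := exists_bound_of_continuous (hblkc hx)
    -- the member's one-link re-weighting: bounded, measurable, oscillation `≤ a`
    have hHm : ∀ U : LGConfig d (SUN N), Measurable fun g : SUN N => -hamiltonianIn W supp {x} (update U x g) := fun U =>
      ((measurable_hamiltonianIn hWm supp {x}).comp (measurable_update U)).neg
    obtain ⟨MH, hMH⟩ := exists_bound_of_continuous (continuous_hamiltonianIn supp hWc {x})
    have hHosc : ∀ (U : LGConfig d (SUN N)) (g g' : SUN N),
        -hamiltonianIn W supp {x} (update U x g) - -hamiltonianIn W supp {x} (update U x g') ≤ a := fun U g g' => by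
      linarith [hamiltonianIn_singleton_update_osc (W := W) (supp := supp) hosc x U g' g, hosca x]
    -- pointwise in `U`: inner integral = bias² + conditional variance ≤ bias² + e^{a} K₀⁻¹ · block average
    have hpt : ∀ U, ∫ σ, (F U - F σ) ^ 2 ∂(γ {x} U) ≤ (F U - m U) ^ 2 + Real.exp a * K₀⁻¹ * siteAvg γ x (blk x) U := by
      intro U
      haveI := hlaw U
      have e1 : ∫ σ, (F U - F σ) ^ 2 ∂(γ {x} U) = ∫ s, (F U - F (update U x s)) ^ 2 ∂(siteLaw γ x U) :=
        siteAvg_eq_integral_siteLaw hγ x (f := fun σ => (F U - F σ) ^ 2) ((measurable_const.sub hFm).pow_const 2) U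
      have hψm : Measurable fun s : SUN N => F (update U x s) := hFm.comp (measurable_update U)
      rw [e1, integral_sq_sub_eq_sq_add_variance (siteLaw γ x U) hψm (fun s => hM _) (F U), ← hm_eq U]
      refine add_le_add le_rfl ?_
      rw [siteAvg_eq_integral_siteLaw hγ x (hblkc hx).measurable U]
      simp_rw [hblk_of_mem hx, hFeq, hcfg_upd hx]
      rw [hm_eq U]
      simp_rw [hFeq, hcfg_upd hx]
      -- the member's one-link law: `ν_B` re-weighted by `e^{−H}`
      rw [hγdef, siteLaw_perturbedYM_thooft β hWm supp x U]
      set B := stapleField β x U with hBdef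
      set ν : Measure (SUN N) := (haarSU N).tilted fun g : SUN N => (N : ℝ) * ((g : Matrix (Fin N) (Fin N) ℂ) * B).trace.re with hν
      have hlinc : Continuous fun g : SUN N => Real.exp (pot (N : ℝ) B g) :=
        Real.continuous_exp.comp (SUNBakryEmery.continuous_restrict (SUNBakryEmery.contDiff_pot _ B))
      have hlin_int : Integrable (fun g : SUN N => Real.exp ((N : ℝ) * ((g : Matrix (Fin N) (Fin N) ℂ) * B).trace.re)) (haarSU N) :=
        SUNBakryEmery.integrable_of_continuous_SUN hlinc _
      haveI : IsProbabilityMeasure ν := isProbabilityMeasure_tilted hlin_int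
      have hsplit : (haarProbability (SUN N)).tilted (fun g : SUN N => (N : ℝ) * ((g : Matrix (Fin N) (Fin N) ℂ) * B).trace.re -
          hamiltonianIn W supp {x} (update U x g)) = ν.tilted fun g => -hamiltonianIn W supp {x} (update U x g) := by
        rw [hν, tilted_tilted hlin_int]
        congr 1
      rw [hsplit]
      -- one-link Bakry–Émery for the section, then Holley–Stroock
      have hBop : matrixOpNorm B ≤ |β| * (2 * ((d : ℝ) - 1)) := matrixOpNorm_stapleField_le hd hN β x U
      have hK1 : K₀ ≤ (N : ℝ) / 2 - N * matrixOpNorm B := by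
        have : (N : ℝ) * matrixOpNorm B ≤ N * (|β| * (2 * ((d : ℝ) - 1))) := mul_le_mul_of_nonneg_left hBop hNpos.le
        rw [hK₀def]; linarith
      have hK1pos : 0 < (N : ℝ) / 2 - N * matrixOpNorm B := lt_of_lt_of_le hK₀ hK1
      have hsec := section_variance_le hN0 hf (cfgV U) ⟨x, hx⟩ B hK1pos
      have hψc : Continuous fun g : SUN N => f (update (cfgV U) ⟨x, hx⟩ (g : Matrix (Fin N) (Fin N) ℂ)) :=
        SUNBakryEmery.continuous_restrict (contDiff_section hf (cfgV U) ⟨x, hx⟩)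
      obtain ⟨Mψ, hMψ⟩ := exists_bound_of_continuous hψc
      have hGc : Continuous fun g : SUN N => ∑ α : FrameIdx N, algD (lk (⟨x, hx⟩ : ↥V) (frame α)) f (update (cfgV U) ⟨x, hx⟩ (g : Matrix (Fin N) (Fin N) ℂ)) ^ 2 :=
        (continuous_finsetSum _ fun α _ => (contDiff_algD hf _).continuous.pow 2).comp (continuous_const.update _ continuous_subtype_val)
      obtain ⟨MG, hMG⟩ := exists_bound_of_continuous hGc
      have hHS := variance_tilted_le_of_osc ν (hHm U) (Bh := MH) (fun g => by rw [abs_neg]; exact hMH _) (hHosc U)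
        hψc.measurable hMψ hGc.measurable (fun g => Finset.sum_nonneg fun α _ => sq_nonneg _) hMG hK1pos.le hsec
      set ν' : Measure (SUN N) := ν.tilted fun g => -hamiltonianIn W supp {x} (update U x g) with hν'
      have hti : Integrable (fun g => Real.exp (-hamiltonianIn W supp {x} (update U x g))) ν := by
        refine Integrable.of_bound (hHm U).exp.aestronglyMeasurable (Real.exp MH) (ae_of_all _ fun g => ?_)
        rw [Real.norm_eq_abs, abs_exp]
        exact Real.exp_le_exp.2 ((neg_le_abs _).trans (hMH _))
      haveI : IsProbabilityMeasure ν' := isProbabilityMeasure_tilted hti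
      have hvar : Var[fun g : SUN N => f (update (cfgV U) ⟨x, hx⟩ (g : Matrix (Fin N) (Fin N) ℂ)); ν'] = ∫ g, (f (update (cfgV U) ⟨x, hx⟩
          (g : Matrix (Fin N) (Fin N) ℂ)) - ∫ g', f (update (cfgV U) ⟨x, hx⟩ (g' : Matrix (Fin N) (Fin N) ℂ)) ∂ν') ^ 2 ∂ν' :=
        variance_eq_integral hψc.measurable.aemeasurable
      have hG0 : 0 ≤ ∫ g, ∑ α : FrameIdx N, algD (lk (⟨x, hx⟩ : ↥V) (frame α)) f (update (cfgV U) ⟨x, hx⟩ (g : Matrix (Fin N) (Fin N) ℂ)) ^ 2 ∂ν' :=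
        integral_nonneg fun g => Finset.sum_nonneg fun α _ => sq_nonneg _
      show ∫ g, (f (update (cfgV U) ⟨x, hx⟩ (g : Matrix (Fin N) (Fin N) ℂ)) - ∫ g', f (update (cfgV U) ⟨x, hx⟩ (g' : Matrix (Fin N) (Fin N) ℂ)) ∂ν') ^ 2 ∂ν' ≤
        Real.exp a * K₀⁻¹ * ∫ g, ∑ α : FrameIdx N, algD (lk (⟨x, hx⟩ : ↥V) (frame α)) f (update (cfgV U) ⟨x, hx⟩ (g : Matrix (Fin N) (Fin N) ℂ)) ^ 2 ∂ν'
      rw [← hvar, mul_assoc, ← div_eq_inv_mul, mul_div_assoc', le_div_iff₀ hK₀]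
      calc Var[fun g : SUN N => f (update (cfgV U) ⟨x, hx⟩ (g : Matrix (Fin N) (Fin N) ℂ)); ν'] * K₀
          ≤ Var[fun g : SUN N => f (update (cfgV U) ⟨x, hx⟩ (g : Matrix (Fin N) (Fin N) ℂ)); ν'] * ((N : ℝ) / 2 - N * matrixOpNorm B) :=
            mul_le_mul_of_nonneg_left hK1 (variance_nonneg _ _)
        _ ≤ _ := by rw [mul_comm]; exact hHS
    -- integrate over the kernel; consistency `γ_V γ_{x} = γ_V` twice
    have hxV : ({x} : Finset (ZdEdge d)) ⊆ V := Finset.singleton_subset_iff.2 hx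
    have hI0 : Integrable (fun U => ∫ σ, (F U - F σ) ^ 2 ∂(γ {x} U)) μ :=
      HeatBath.integrable_of_abs_le (HeatBathPoincareZd.measurable_integral_sq_sub hγ x hFm hM)
        (fun U => HeatBathPoincareZd.abs_integral_sq_sub_le hγ x hM U)
    have hI1 : Integrable (fun U => (F U - m U) ^ 2) μ := HeatBath.integrable_of_abs_le hh hhb
    have hI2 : Integrable (fun U => Real.exp a * K₀⁻¹ * siteAvg γ x (blk x) U) μ :=
      (HeatBath.integrable_of_abs_le (measurable_siteAvg hγ x (hblkc hx).measurable) (fun U => abs_siteAvg_le hγ x hMb U)).const_mul _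
    have hDLR1 : ∫ U, (F U - m U) ^ 2 ∂μ = ∫ U, siteAvg γ x (fun U' => (F U' - m U') ^ 2) U ∂μ :=
      (hγ.integral_integral_eq_of_subset hxV η (hI1 : Integrable (fun U => (F U - m U) ^ 2) (γ V η))).symm
    have hDLR1' : ∀ U, siteAvg γ x (fun U' => (F U' - m U') ^ 2) U ≤ Real.exp a * K₀⁻¹ * siteAvg γ x (blk x) U := by
      intro U
      haveI := hlaw U
      have e1 : siteAvg γ x (fun U' => (F U' - m U') ^ 2) U = ∫ s, (F (update U x s) - m U) ^ 2 ∂(siteLaw γ x U) := by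
        rw [siteAvg_eq_integral_siteLaw hγ x hh U]
        simp only [hm_upd]
      have hψm : Measurable fun s : SUN N => F (update U x s) := hFm.comp (measurable_update U)
      have e2 : ∫ s, (F (update U x s) - m U) ^ 2 ∂(siteLaw γ x U) = ∫ σ, (F U - F σ) ^ 2 ∂(γ {x} U) - (F U - m U) ^ 2 := by
        have e4 : ∫ σ, (F U - F σ) ^ 2 ∂(γ {x} U) = ∫ s, (F U - F (update U x s)) ^ 2 ∂(siteLaw γ x U) :=
          siteAvg_eq_integral_siteLaw hγ x (f := fun σ => (F U - F σ) ^ 2) ((measurable_const.sub hFm).pow_const 2) U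
        rw [e4, integral_sq_sub_eq_sq_add_variance (siteLaw γ x U) hψm (fun s => hM _) (F U), ← hm_eq U]
        ring
      rw [e1, e2]
      linarith [hpt U]
    have hDLR2 : ∫ U, siteAvg γ x (blk x) U ∂μ = ∫ U, blk x U ∂μ :=
      hγ.integral_integral_eq_of_subset hxV η (HeatBath.integrable_of_abs_le (hblkc hx).measurable hMb)
    have hstep1 : ∫ U, ∫ σ, (F U - F σ) ^ 2 ∂(γ {x} U) ∂μ ≤ ∫ U, (F U - m U) ^ 2 ∂μ + ∫ U, Real.exp a * K₀⁻¹ * siteAvg γ x (blk x) U ∂μ := by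
      rw [← integral_add hI1 hI2]
      exact integral_mono hI0 (hI1.add hI2) hpt
    have hstep2 : ∫ U, (F U - m U) ^ 2 ∂μ ≤ ∫ U, Real.exp a * K₀⁻¹ * siteAvg γ x (blk x) U ∂μ := by
      rw [hDLR1]
      exact integral_mono (HeatBath.integrable_of_abs_le (measurable_siteAvg hγ x hh) (fun U => abs_siteAvg_le hγ x hhb U)) hI2 hDLR1'
    rw [integral_const_mul, hDLR2] at hstep1 hstep2
    linarith
  -- SUM OVER THE VOLUME
  have hsum : ∑ x ∈ V, ∫ U, ∫ σ, (F U - F σ) ^ 2 ∂(γ {x} U) ∂μ ≤ 2 * (Real.exp a * K₀⁻¹) * ∫ U, Gam f f (cfgV U) ∂μ := by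
    calc _ ≤ ∑ x ∈ V, 2 * (Real.exp a * K₀⁻¹) * ∫ U, blk x U ∂μ := Finset.sum_le_sum key
      _ = 2 * (Real.exp a * K₀⁻¹) * ∫ U, Gam f f (cfgV U) ∂μ := by
          rw [← Finset.mul_sum, ← integral_finsetSum _ fun x hx =>
            HeatBath.integrable_of_abs_le (hblkc hx).measurable (Classical.choose_spec (exists_bound_of_continuous (hblkc hx)))]
          congr 1
          refine integral_congr_ae (ae_of_all _ fun U => ?_)
          show ∑ i ∈ V, blk i U = Gam f f (cfgV U)
          rw [Gam_eq_sum_blocks, ← Finset.sum_attach]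
          exact Finset.sum_congr rfl fun i _ => hblk_of_mem i.2 U
  -- ASSEMBLY
  calc Var[F; μ] ≤ (2 * (1 - c))⁻¹ * ∑ x ∈ V, ∫ U, ∫ σ, (F U - F σ) ^ 2 ∂(γ {x} U) ∂μ := hHB
    _ ≤ (2 * (1 - c))⁻¹ * (2 * (Real.exp a * K₀⁻¹) * ∫ U, Gam f f (cfgV U) ∂μ) := mul_le_mul_of_nonneg_left hsum (by positivity)
    _ = Real.exp a * ((1 - c) * K₀)⁻¹ * ∫ U, Gam f f (cfgV U) ∂μ := by field_simp

/-- ★★ **`SU(2)`, EVERY DIMENSION, QUARTER MODULUS — the Langevin Poincaré inequality of every finite volume of the `ℤ^d` ball member with every boundary field**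
(tree coupling `β_W/2`, 't Hooft `β_W/4`; `(d−1)β_W/2 ≤ 1`): with per-link loads `(a, ℓ_s)` and column load `Λc`, if
`c := (3/2)(d−1)β_W e^{a}(1 + 2√2 ℓ_s) + √2 Λc < 1` and `K₀ := 1 − (d−1)β_W > 0`, then `Var_{γ^W_V(·|η)}(f) ≤ e^{a}((1 − c)K₀)⁻¹ ∫ Γ(f,f) dγ^W_V(·|η)`. [folklore] -/
theorem su2_kernel_variance_le_integral_Gam_onBall_quarter (hd : 1 ≤ d) {βW a ℓs Λc c : ℝ} (h0 : 0 ≤ βW) (hβ : ((d : ℝ) - 1) * βW / 2 ≤ 1)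
    (hK₀ : 0 < 1 - ((d : ℝ) - 1) * βW) (hℓs : 0 ≤ ℓs) {W : Potential (ZdEdge d) (SUN 2)} (hWc : ∀ X, Continuous (W X))
    (hWdep : ∀ X, DependsOn (W X) (↑X : Set (ZdEdge d)))
    {supp : Finset (ZdEdge d) → Finset (Finset (ZdEdge d))} (hsupp : W.IsSupportedBy supp)
    {osc : Finset (ZdEdge d) → ZdEdge d → ℝ} (hosc : ∀ X, Dobrushin.IsOscBound (W X) (osc X))
    (hosca : ∀ e, ∑ X ∈ (supp {e}).filter (fun X => e ∈ X), osc X e ≤ a)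
    {lip : Finset (ZdEdge d) → ZdEdge d → ℝ} (hlip : ∀ X, IsLipBound suFrobDist (W X) (lip X))
    (hlips : ∀ e, ∑ X ∈ (supp {e}).filter (fun X => e ∈ X), lip X e ≤ ℓs)
    (hcol : ∀ (y : ZdEdge d) (T : Finset (ZdEdge d)), y ∉ T → ∑ e ∈ T, ∑ X ∈ (supp {e}).filter (fun X => e ∈ X), lip X y ≤ Λc)
    (hc : 3 / 2 * ((d : ℝ) - 1) * βW * (Real.exp a * (1 + 2 * Real.sqrt 2 * ℓs)) + Real.sqrt 2 * Λc ≤ c) (hc1 : c < 1)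
    (V : Finset (ZdEdge d)) (η : LGConfig d (SUN 2)) {f : Cfg ↥V 2 → ℝ} (hf : ContDiff ℝ ∞ f) :
    Var[matrixCylinder V f; perturbedYM (fundamentalRep (Fin 2)) ((2 : ℕ) * (βW / 4)) W supp V η] ≤
      Real.exp a * ((1 - c) * (1 - ((d : ℝ) - 1) * βW))⁻¹ *
        ∫ U, Gam f f (fun e : ↥V => (U e : Matrix (Fin 2) (Fin 2) ℂ)) ∂(perturbedYM (fundamentalRep (Fin 2)) ((2 : ℕ) * (βW / 4)) W supp V η) := by
  have hdd : (0 : ℝ) ≤ (d : ℝ) - 1 := by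
    have : (1 : ℝ) ≤ d := by exact_mod_cast hd
    linarith
  have habs : |βW / 4| = βW / 4 := abs_of_nonneg (by positivity)
  have key := kernel_variance_le_integral_Gam_onBall (N := 2) hd (by norm_num) (β := βW / 4) zero_le_one hℓs (b := ((d : ℝ) - 1) * βW / 2)
    (by rw [habs]; nlinarith) (SlabAreaLawDimensions.su2_oneLinkKRModulus_of_le_one hβ) hWc hWdep hsupp hosc hosca hlip hlips hcol
    (c := c) (by rw [habs]; push_cast; nlinarith [hc]) hc1 (by rw [habs]; push_cast; nlinarith [hK₀]) V η hf
  have e : ((2 : ℕ) : ℝ) / 2 - (2 : ℕ) * |βW / 4| * (2 * ((d : ℝ) - 1)) = 1 - ((d : ℝ) - 1) * βW := by rw [habs]; push_cast; ring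
  rw [e] at key
  exact key

end Summit.Ventures.YMGap.RobustBall.LangevinPoincare

end
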